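import Summits.QuantumAdvantage.QuantumAdvantage.Theorems.ThirdFactorialPincerJacobiCubeLemmas

/-!
# QuantumAdvantage / ThirdFactorialPincer — `JacobiCube` (stmt-QuantumAdvantage-11647), part 2: the theorem

**Jacobi (1837) / Gauss.** For a prime `p ≡ 1 (mod 3)` there are integers `L, M` with
`4p = L² + 27M²` and `L ≡ 1 (mod 3)`; such an `L` is unique, and with `K = (p − 1)/3`
`(K!)³ · L ≡ (−1)^K (mod p)`.

This file: the Jacobi-sum core (`jacobi_core`: the cubic character `χ` with `χ(g) = ω` on a
generator `g` of `𝔽_pˣ`, `J(χ,χ) = a + bω` by sorting `x ∉ {0,1}` into three classes, `J·J̄ = p`,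
`J ≡ −1 (mod (1−ω)²)`, and `2a − b ≡ Σ x^K(1−x)^K + Σ x^{2K}(1−x)^{2K} ≡ −C(2K,K) (mod p)`), then
the theorem from Wilson (`wilson_cube`) and the uniqueness of `L` (`L_unique`), both in part 1
(`ThirdFactorialPincerJacobiCubeLemmas.lean`, where the full proof sketch and references are).

HONEST FRAMING (block-2b rule): the value here is a closed ledger item (a classical theorem,
kernel-checked), not summit progress.

References: Ireland–Rosen, GTM 84 (1990), Ch. 8 §3, Ch. 9 §4 [IrelandRosen1990];
Berndt–Evans–Williams, *Gauss and Jacobi Sums* (1998), Thm 2.1.5, §3.1 [BerndtEvans1981];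
Hudson–Williams, Trans. AMS 281 (1984) [HudsonWilliams1984].
-/

set_option linter.dupNamespace false -- D-0017: single-problem summit ⇒ `QuantumAdvantage.QuantumAdvantage` by design

namespace Summit.QuantumAdvantage.QuantumAdvantage.Theorems.JacobiCube

open Finset

/-! ### Part J — the Jacobi sum of the cubic character and the core computation -/

/-- **Core of Jacobi's theorem.** For `p ≡ 1 (3)` prime and `3K = p − 1`, `K > 0` even, there
are integers `a ≡ −1`, `b ≡ 0 (mod 3)` with `a² − ab + b² = p` (`a + bω = J(χ,χ)` for the cubic
character `χ` with `χ(g) = ω`) and `2a − b ≡ −C(2K, K) (mod p)`.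
[Ireland–Rosen 1990, Ch. 8 §3, Ch. 9 §4; Berndt–Evans–Williams Thm 2.1.5] -/
theorem jacobi_core {p : ℕ} [hp : Fact p.Prime] {K : ℕ} (hK : 3 * K = p - 1) (hK0 : 0 < K)
    (hKeven : Even K) :
    ∃ a b : ℤ, a ^ 2 - a * b + b ^ 2 = p ∧ a % 3 = 2 ∧ b % 3 = 0 ∧
      ((2 * a - b : ℤ) : ZMod p) = -((2 * K).choose K : ZMod p) := by
  classical
  -- a generator of `𝔽_pˣ`
  obtain ⟨g, hg⟩ := IsCyclic.exists_generator (α := (ZMod p)ˣ)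
  have hcard : Fintype.card (ZMod p)ˣ = p - 1 := ZMod.card_units p
  have horder : orderOf g = p - 1 := by
    rw [orderOf_eq_card_of_forall_mem_zpowers hg, Nat.card_eq_fintype_card, hcard]
  -- the cubic character `χ` with `χ(g) = ω`
  set ω : ℂ := Complex.exp (2 * Real.pi * Complex.I / 3) with hω_def
  have hω3 : IsPrimitiveRoot ω 3 := Complex.isPrimitiveRoot_exp 3 (by norm_num)
  have ω_pow_three : ω ^ 3 = 1 := hω3.pow_eq_one
  have hω1 : ω ≠ 1 := hω3.ne_one (by norm_num)
  have hω21 : ω ^ 2 ≠ 1 := hω3.pow_ne_one_of_pos_of_lt (by norm_num) (by norm_num)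
  set ωu : ℂˣ := (hω3.isUnit (by norm_num)).unit with hωu_def
  have hωu_val : (ωu : ℂ) = ω := rfl
  have hωu : ωu ∈ rootsOfUnity (Fintype.card (ZMod p)ˣ) ℂ := by
    rw [mem_rootsOfUnity', hcard, hωu_val, ← hK, pow_mul, ω_pow_three, one_pow]
  set χ : MulChar (ZMod p) ℂ := MulChar.ofRootOfUnity hωu hg with hχ_def
  have hχg : χ (g : ZMod p) = ω := by
    rw [hχ_def, MulChar.ofRootOfUnity_spec hωu hg, hωu_val]
  have hχ1 : χ ≠ 1 := by
    rw [Ne, MulChar.eq_iff hg, hχg, MulChar.one_apply_coe]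
    exact hω1
  have hχ2 : χ * χ ≠ 1 := by
    rw [Ne, MulChar.eq_iff hg, MulChar.mul_apply, hχg, MulChar.one_apply_coe, ← sq]
    exact hω21
  have hχ3 : χ ^ 3 = 1 := by
    rw [MulChar.eq_iff hg, MulChar.pow_apply_coe, hχg, MulChar.one_apply_coe, ω_pow_three]
  -- `ρ = g^K`, a primitive cube root of unity in `𝔽_p`
  set ρ : ZMod p := (g : ZMod p) ^ K with hρ_def
  have hg0 : (g : ZMod p) ≠ 0 := Units.ne_zero g
  have hρ3 : ρ ^ 3 = 1 := by
    rw [hρ_def, ← pow_mul, mul_comm, hK]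
    exact ZMod.pow_card_sub_one_eq_one hg0
  have hρ1 : ρ ≠ 1 := by
    intro h
    have hu : g ^ K = 1 := Units.ext (by rw [Units.val_pow_eq_pow_val, Units.val_one]; exact h)
    exact pow_ne_one_of_lt_orderOf hK0.ne' (by rw [horder]; omega) hu
  have hρ2 : ρ ^ 2 + ρ + 1 = 0 := by
    have h : (ρ - 1) * (ρ ^ 2 + ρ + 1) = 0 := by
      have : (ρ - 1) * (ρ ^ 2 + ρ + 1) = ρ ^ 3 - 1 := by ring
      rw [this, hρ3, sub_self]
    exact (mul_eq_zero.1 h).resolve_left (sub_ne_zero.2 hρ1)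
  -- discrete logarithms: `χ x = ω^n`, `x^K = ρ^n`
  have hlog : ∀ x : ZMod p, x ≠ 0 → ∃ n : ℕ, χ x = ω ^ n ∧ x ^ K = ρ ^ n := by
    intro x hx
    obtain ⟨n, hn⟩ := (Submonoid.mem_powers_iff _ _).1
      (((isOfFinOrder_of_finite g).mem_powers_iff_mem_zpowers).2 (hg (Units.mk0 x hx)))
    have hxn : x = ((g ^ n : (ZMod p)ˣ) : ZMod p) := by rw [hn]; rfl
    refine ⟨n, ?_, ?_⟩
    · rw [hxn, Units.val_pow_eq_pow_val, map_pow, hχg]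
    · rw [hxn, Units.val_pow_eq_pow_val, ← pow_mul, mul_comm, pow_mul]
  choose! nlog hnlog using hlog
  -- the classes
  set S : Finset (ZMod p) := Finset.univ.filter fun x => x ≠ 0 ∧ x ≠ 1 with hS
  have hSmem : ∀ x ∈ S, x ≠ 0 ∧ 1 - x ≠ 0 := by
    intro x hx
    rw [hS, Finset.mem_filter] at hx
    exact ⟨hx.2.1, sub_ne_zero.2 (Ne.symm hx.2.2)⟩
  set c : ZMod p → ℕ := fun x => (nlog x + nlog (1 - x)) % 3 with hc
  have hc3 : ∀ x ∈ S, c x < 3 := fun x _ => Nat.mod_lt _ (by norm_num)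
  have hcdiv : ∀ x, nlog x + nlog (1 - x) = 3 * ((nlog x + nlog (1 - x)) / 3) + c x :=
    fun x => (Nat.div_add_mod _ 3).symm
  have hJterm : ∀ x ∈ S, χ x * χ (1 - x) = ω ^ c x := by
    intro x hx
    obtain ⟨hx0, hx1⟩ := hSmem x hx
    rw [(hnlog x hx0).1, (hnlog (1 - x) hx1).1, ← pow_add, hcdiv x, pow_add, pow_mul,
      ω_pow_three, one_pow, one_mul]
  have hTterm : ∀ x ∈ S, x ^ K * (1 - x) ^ K = ρ ^ c x := by
    intro x hx
    obtain ⟨hx0, hx1⟩ := hSmem x hx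
    rw [(hnlog x hx0).2, (hnlog (1 - x) hx1).2, ← pow_add, hcdiv x, pow_add, pow_mul, hρ3,
      one_pow, one_mul]
  have hT2term : ∀ x ∈ S, x ^ (2 * K) * (1 - x) ^ (2 * K) = ρ ^ (2 * c x) := by
    intro x hx
    rw [mul_comm 2 K, pow_mul, pow_mul, ← mul_pow, hTterm x hx, ← pow_mul, mul_comm]
  -- restricting the three sums to `S`
  have hoff : ∀ x : ZMod p, x ∉ S → x = 0 ∨ x = 1 := by
    intro x hx
    rw [hS, Finset.mem_filter] at hx
    by_contra h
    exact hx ⟨Finset.mem_univ _, not_or.1 h⟩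
  have hJS : jacobiSum χ χ = ∑ x ∈ S, ω ^ c x := by
    rw [jacobiSum, ← Finset.sum_congr rfl hJterm]
    refine (Finset.sum_subset (Finset.subset_univ S) fun x _ hx => ?_).symm
    rcases hoff x hx with rfl | rfl
    · rw [MulChar.map_zero, zero_mul]
    · rw [sub_self, MulChar.map_zero, mul_zero]
  have hTS : ∑ x : ZMod p, x ^ K * (1 - x) ^ K = ∑ x ∈ S, ρ ^ c x := by
    rw [← Finset.sum_congr rfl hTterm]
    refine (Finset.sum_subset (Finset.subset_univ S) fun x _ hx => ?_).symm
    rcases hoff x hx with rfl | rfl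
    · rw [zero_pow hK0.ne', zero_mul]
    · rw [sub_self, zero_pow hK0.ne', mul_zero]
  have hT2S : ∑ x : ZMod p, x ^ (2 * K) * (1 - x) ^ (2 * K) = ∑ x ∈ S, ρ ^ (2 * c x) := by
    rw [← Finset.sum_congr rfl hT2term]
    refine (Finset.sum_subset (Finset.subset_univ S) fun x _ hx => ?_).symm
    rcases hoff x hx with rfl | rfl
    · rw [zero_pow (by omega), zero_mul]
    · rw [sub_self, zero_pow (by omega), mul_zero]
  -- the counts
  set N0 : ℕ := (S.filter fun x => c x = 0).card with hN0
  set N1 : ℕ := (S.filter fun x => c x = 1).card with hN1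
  set N2 : ℕ := (S.filter fun x => c x = 2).card with hN2
  have hJN : jacobiSum χ χ = N0 + N1 * ω + N2 * ω ^ 2 := by
    rw [hJS, sum_three_classes S c hc3 (fun m => ω ^ m)]
    simp only [nsmul_eq_mul, pow_zero, mul_one, pow_one, hN0, hN1, hN2]
  have hTN : (N0 : ZMod p) + N1 * ρ + N2 * ρ ^ 2 = 0 := by
    rw [← sum_binom_K hK hK0, hTS, sum_three_classes S c hc3 (fun m => ρ ^ m)]
    simp only [nsmul_eq_mul, pow_zero, mul_one, pow_one, hN0, hN1, hN2]
  have hT2N : (N0 : ZMod p) + N1 * ρ ^ 2 + N2 * ρ ^ 4 = -((2 * K).choose K : ZMod p) := by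
    have h := sum_binom_2K hK hK0
    rw [hKeven.neg_one_pow, one_mul, hT2S, sum_three_classes S (fun x => c x) hc3
      (fun m => ρ ^ (2 * m))] at h
    simpa only [nsmul_eq_mul, mul_zero, pow_zero, mul_one, show 2 * 1 = 2 by rfl,
      show 2 * 2 = 4 by rfl] using h
  -- `a`, `b`
  refine ⟨(N0 : ℤ) - N2, (N1 : ℤ) - N2, ?_, ?_⟩
  · -- the norm: `J · J̄ = p`
    have hJab : jacobiSum χ χ = (((N0 : ℤ) - N2 : ℤ) : ℂ) + (((N1 : ℤ) - N2 : ℤ) : ℂ) * ω := by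
      rw [hJN]
      push_cast
      linear_combination (N2 : ℂ) * (ω_sq_add hω3)
    have hconj : starRingEnd ℂ (jacobiSum χ χ) =
        ((((N0 : ℤ) - N2 : ℤ) - ((N1 : ℤ) - N2 : ℤ) : ℤ) : ℂ) - (((N1 : ℤ) - N2 : ℤ) : ℂ) * ω := by
      rw [hJN, map_add, map_add, map_mul, map_mul, map_pow, conj_ω hω3, map_natCast, map_natCast,
        map_natCast]
      push_cast
      have h4 : (ω ^ 2) ^ 2 = ω := by
        rw [← pow_mul, show 2 * 2 = 3 + 1 by rfl, pow_add, ω_pow_three, one_mul, pow_one]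
      rw [h4]
      linear_combination (N1 : ℂ) * (ω_sq_add hω3)
    have hchar : ringChar ℂ ≠ ringChar (ZMod p) := by
      rw [ringChar.eq_zero, ZMod.ringChar_zmod_n]
      exact (hp.out.ne_zero).symm
    have hnorm := jacobiSum_mul_jacobiSum_inv hchar hχ1 hχ1 hχ2
    rw [ZMod.card, ← MulChar.star_eq_inv, show star χ = χ.ringHomComp (starRingEnd ℂ) from rfl,
      jacobiSum_ringHomComp, hconj, hJab] at hnorm
    have h : ((((N0 : ℤ) - N2) ^ 2 - ((N0 : ℤ) - N2) * ((N1 : ℤ) - N2) + ((N1 : ℤ) - N2) ^ 2 : ℤ)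
        : ℂ) = (p : ℤ) := by
      push_cast at hnorm ⊢
      linear_combination hnorm + ((N1 : ℂ) - N2) ^ 2 * (ω_sq_add hω3)
    exact_mod_cast h
  · -- primary normalisation and the congruence
    have hJab : jacobiSum χ χ = (((N0 : ℤ) - N2 : ℤ) : ℂ) + (((N1 : ℤ) - N2 : ℤ) : ℂ) * ω := by
      rw [hJN]
      push_cast
      linear_combination (N2 : ℂ) * (ω_sq_add hω3)
    obtain ⟨z, hz, hJz⟩ := exists_jacobiSum_eq_neg_one_add (n := 3) (by norm_num) hχ3 hχ3
      (by rw [ZMod.card, ← hK]; exact Dvd.intro K rfl) hω3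
    obtain ⟨c', d', rfl⟩ := nf_exists hω3 hz
    have hprim : jacobiSum χ χ = ((3 * d' - 1 : ℤ) : ℂ) + ((3 * d' - 3 * c' : ℤ) : ℂ) * ω := by
      rw [hJz]
      push_cast
      linear_combination ((d' : ℂ) * ω + (c' - 3 * d')) * (ω_sq_add hω3)
    obtain ⟨ha, hb⟩ := nf_unique hω3 (hJab.symm.trans hprim)
    refine ⟨by omega, by omega, ?_⟩
    -- the congruence `2a − b ≡ −C(2K,K)`: add `T = 0` and `T₂ = −C`
    have hρ4 : ρ ^ 4 = ρ := by
      rw [show 4 = 3 + 1 by rfl, pow_add, hρ3, one_mul, pow_one]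
    rw [← add_zero (-((2 * K).choose K : ZMod p)), ← hTN, ← hT2N, hρ4]
    push_cast
    linear_combination (-(N1 : ZMod p) - N2) * hρ2

/-! ### The theorem -/

/-- **`JacobiCube`** (stmt-QuantumAdvantage-11647; Jacobi 1837 / Gauss): for `p ≡ 1 (mod 3)`
prime there are `L, M ∈ ℤ` with `4p = L² + 27M²`, `L ≡ 1 (mod 3)`; and for every such pair,
`((p−1)/3)!³ · L ≡ (−1)^{(p−1)/3} (mod p)` (from Jacobi's binomial congruence
`C(2K,K) ≡ −L (mod p)` and Wilson's theorem; `L` is unique).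
[Ireland–Rosen 1990, Ch. 8 §3, Ch. 9 §4; Berndt–Evans–Williams 1998, Thm 2.1.5, §3.1;
Hudson–Williams 1984] -/
theorem jacobiCube_proof :
    Summit.QuantumAdvantage.QuantumAdvantage.Theses.ThirdFactorialPincer.JacobiCube := by
  unfold Summit.QuantumAdvantage.QuantumAdvantage.Theses.ThirdFactorialPincer.JacobiCube
  intro p hp hp3
  haveI : Fact p.Prime := ⟨hp⟩
  obtain ⟨K, hK⟩ : ∃ K, 3 * K = p - 1 := ⟨(p - 1) / 3, by omega⟩
  have hKdef : (p - 1) / 3 = K := by omega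
  have hK0 : 0 < K := by have := hp.two_le; omega
  have hKeven : Even K := by
    have h2 : p % 2 = 1 := Nat.odd_iff.1 (hp.odd_of_ne_two (by omega))
    exact Nat.even_iff.2 (by omega)
  rw [hKdef]
  obtain ⟨a, b, hnorm, ha3, hb3, hcong⟩ := jacobi_core hK hK0 hKeven
  obtain ⟨M, hM⟩ : ∃ M : ℤ, b = 3 * M := ⟨b / 3, by omega⟩
  have h4p : 4 * (p : ℤ) = (2 * a - b) ^ 2 + 27 * M ^ 2 := by
    rw [← hnorm, hM]
    ring
  have hL3 : (2 * a - b) % 3 = 1 := by omega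
  refine ⟨⟨2 * a - b, M, h4p, hL3⟩, fun L' M' h' hL' => ?_⟩
  have hp3' : (p : ℤ) % 3 = 1 := by exact_mod_cast hp3
  have hLL' : 2 * a - b = L' := L_unique hp3' (Nat.prime_iff_prime_int.1 hp) h4p h' hL3 hL'
  rw [← hLL', hcong]
  have hw := wilson_cube hK
  rw [hKeven.neg_one_pow]
  rw [hKeven.neg_one_pow, mul_one] at hw
  linear_combination -hw

end Summit.QuantumAdvantage.QuantumAdvantage.Theorems.JacobiCube
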